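import Mathlib.Data.Nat.Choose.Vandermonde
import Mathlib.Data.Nat.Log
import Literature.Combinatorics.Additive.TricoloredSumFreeBound
import Literature.Computability.MetaComplexity.RazborovSmolenskyPoly
import HarnessLib

/-!
# Exact low-degree polynomials for a threshold on a Hamming-weight WINDOW, over `𝔽_p`

The interpolation ingredient of Alman–Williams 2015 (Lemma 3.1 = Srinivasan–Tripathi–Venkitesh
2021, Thm. 21): a symmetric polynomial of degree proportional to the window WIDTH that agrees
with the threshold function `Thr_n^t = [|x| ≥ t]` on all inputs whose weight lies in the window
`[t − W, t + W]`. Alman–Williams prove it over `ℤ` by a unimodular binomial determinant; here we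
give the positive-characteristic version by LUCAS' THEOREM instead (degree `< p·(2W+1)` rather
than `2W`, which the constants `A_p = B_p = 6.4·10⁶·p` of STV Thm. 18 absorb):

* `binomFn F l = (x ↦ C(|x|, l))` is the sum of the multilinear monomials of degree `l`
  (`binomFn_eq_sum_mono`), hence of degree `≤ l`;
* `modInd q c = [|x| ≡ c (mod q)]` has degree `≤ q − 1` over `𝔽_p` for `q = p^k`
  (`modInd_mem_lowDeg`), via Vandermonde `C(|x| + s, q−1) = Σ_l C(s, q−1−l)·C(|x|, l)` and
  Lucas `C(N, p^k − 1) ≡ [N ≡ −1 (mod p^k)] (mod p)` (the tree's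
  `Literature.Combinatorics.Additive.natCast_choose_pow_sub_one`, BCCGNSU 2017 Prop. 4.15);
* `windowThr p t W = Σ_{j ≤ W} [|x| ≡ t + j (mod q)]`, `q = p^{⌊log_p(2W)⌋+1} ∈ (2W, p(2W+1)]`,
  has degree `≤ p(2W+1)` (`windowThr_mem_lowDeg`) and equals `[t ≤ |x|]` whenever
  `t ≤ |x| + W` and `|x| ≤ t + W` (`windowThr_apply`).

All statements are about functions on the cube (`Smolensky.CubeFn`, filtration `lowDeg`).

## References

* J. Alman, R. Williams, *Probabilistic polynomials and Hamming nearest neighbors*, FOCS 2015,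
  Lemma 3.1 [AlmanWilliams2015].
* S. Srinivasan, U. Tripathi, S. Venkitesh, SIAM J. Discrete Math. 35 (2021), Theorem 21 and
  §3.2 (Lucas' theorem and `MOD_{p^t}` as elementary symmetric polynomials of degree `< p^t`)
  [SrinivasanTripathiVenkitesh2021].
-/

noncomputable section

namespace Literature.Computability.MetaComplexity

open Finset Literature.Computability.Complexity

namespace Smolensky

open scoped Classical

variable {F : Type*} [Field F] {n : ℕ}

/-! ### Binomial coefficients of the weight are low-degree -/

/-- `x ↦ C(|x|, l)` as a function on the cube with values in `F`.
[cite: SrinivasanTripathiVenkitesh2021, §3.2 (elementary symmetric polynomials)] -/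
def binomFn (F : Type*) [Field F] {n : ℕ} (l : ℕ) : CubeFn F n :=
  fun x => ((GateFn.numOnes x).choose l : F)

/-- `C(|x|, l) = Σ_{|S| = l} x_S` — the `l`-th elementary symmetric polynomial on the cube.
[cite: SrinivasanTripathiVenkitesh2021, §3.2 (elementary symmetric polynomials)] -/
theorem binomFn_eq_sum_mono (l : ℕ) :
    binomFn F l = ∑ S ∈ (univ : Finset (Fin n)).powersetCard l, mono F S := by
  funext x
  rw [Finset.sum_apply]
  simp only [mono_apply]
  rw [Finset.sum_boole]
  unfold binomFn GateFn.numOnes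
  have hset : ((univ : Finset (Fin n)).powersetCard l).filter (fun S => ∀ i ∈ S, x i = true) =
      (univ.filter fun i => x i = true).powersetCard l := by
    ext S
    simp only [Finset.mem_filter, Finset.mem_powersetCard, true_and,
      Finset.subset_iff, Finset.mem_univ]
    tauto
  rw [hset, Finset.card_powersetCard]

/-- `x ↦ C(|x|, l)` has degree `≤ l`. [cite: SrinivasanTripathiVenkitesh2021, §3.2] -/
theorem binomFn_mem_lowDeg {l D : ℕ} (h : l ≤ D) : binomFn F l ∈ lowDeg F n D := by
  rw [binomFn_eq_sum_mono]
  refine Submodule.sum_mem _ fun S hS => mono_mem_lowDeg ?_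
  rw [(Finset.mem_powersetCard.1 hS).2]
  exact h

/-! ### `MOD`-`q` indicators of the weight have degree `< q` for `q` a power of `p` -/

/-- The indicator `[|x| ≡ c (mod q)]` as a function on the cube.
[cite: SrinivasanTripathiVenkitesh2021, §3.2 (the functions MOD^i_{p^t})] -/
def modInd (F : Type*) [Field F] {n : ℕ} (q c : ℕ) : CubeFn F n :=
  fun x => if GateFn.numOnes x % q = c % q then 1 else 0

section ModInd

variable {p : ℕ} [hp : Fact p.Prime]

/-- **`[|x| ≡ c (mod p^k)]` has degree `≤ p^k − 1` over `𝔽_p`**: it is `C(|x| + s, p^k − 1)` with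
`s = p^k − 1 − (c mod p^k)` (Lucas), and `C(|x| + s, q−1) = Σ_l C(s, q−1−l)·C(|x|, l)`
(Vandermonde) is a combination of elementary symmetric polynomials of degree `< q`.
[cite: SrinivasanTripathiVenkitesh2021, §3.2 (MOD_{p^t} functions are combinations of elementary symmetric polynomials of degree at most p^t − 1)] -/
theorem modInd_mem_lowDeg (k c : ℕ) {D : ℕ} (hD : p ^ k - 1 ≤ D) :
    modInd (ZMod p) (n := n) (p ^ k) c ∈ lowDeg (ZMod p) n D := by
  set q := p ^ k with hq
  have hq0 : 0 < q := pow_pos hp.out.pos _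
  set s := q - 1 - c % q with hs
  have hcq : c % q < q := Nat.mod_lt _ hq0
  -- the function equals `x ↦ C(|x| + s, q - 1)`
  have hfun : modInd (ZMod p) (n := n) q c =
      ∑ ij ∈ Finset.antidiagonal (q - 1), ((s.choose ij.2 : ℕ) : ZMod p) • binomFn (ZMod p) ij.1 := by
    funext x
    rw [Finset.sum_apply]
    simp only [Pi.smul_apply, smul_eq_mul, binomFn]
    have hv : ∑ ij ∈ Finset.antidiagonal (q - 1),
        ((s.choose ij.2 : ℕ) : ZMod p) * (((GateFn.numOnes x).choose ij.1 : ℕ) : ZMod p) =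
        (((GateFn.numOnes x + s).choose (q - 1) : ℕ) : ZMod p) := by
      rw [Nat.add_choose_eq, Nat.cast_sum]
      refine Finset.sum_congr rfl fun ij _ => ?_
      rw [Nat.cast_mul, mul_comm]
    rw [hv, hq, Literature.Combinatorics.Additive.natCast_choose_pow_sub_one, ← hq]
    unfold modInd
    -- `(|x| + s) % q = q - 1 ↔ |x| % q = c % q`
    have hiff : (GateFn.numOnes x + s) % q = q - 1 ↔ GateFn.numOnes x % q = c % q := by
      have hs' : c % q + s = q - 1 := by omega
      constructor
      · intro h
        have h1 : (GateFn.numOnes x + s) % q = (c % q + s) % q := by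
          rw [h, hs', Nat.mod_eq_of_lt (Nat.sub_lt hq0 one_pos)]
        have h2 := Nat.ModEq.add_right_cancel' s h1
        rw [Nat.ModEq, Nat.mod_mod] at h2
        exact h2
      · intro h
        have h1 : (GateFn.numOnes x + s) % q = (c % q + s) % q := by
          have : GateFn.numOnes x ≡ c % q [MOD q] := by rw [Nat.ModEq, h, Nat.mod_mod]
          exact Nat.ModEq.add_right s this
        rw [h1, hs', Nat.mod_eq_of_lt (Nat.sub_lt hq0 one_pos)]
    by_cases h : GateFn.numOnes x % q = c % q
    · rw [if_pos h, if_pos (hiff.2 h)]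
    · rw [if_neg h, if_neg fun h' => h (hiff.1 h')]
  rw [hfun]
  refine Submodule.sum_mem _ fun ij hij => Submodule.smul_mem _ _ (binomFn_mem_lowDeg ?_)
  have := Finset.mem_antidiagonal.1 hij
  omega

end ModInd

/-! ### The window polynomial for a threshold -/

section Window

variable (p : ℕ) [hp : Fact p.Prime]

/-- The modulus used for a window of half-width `W`: the least power of `p` exceeding `2W`
(namely `p^{⌊log_p(2W)⌋ + 1}`). [cite: AlmanWilliams2015, Lemma 3.1 (degree proportional to the window)] -/
def windowMod (W : ℕ) : ℕ := p ^ (Nat.log p (2 * W) + 1)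

/-- `2W < windowMod p W`. [cite: AlmanWilliams2015, Lemma 3.1] -/
theorem two_mul_lt_windowMod (W : ℕ) : 2 * W < windowMod p W :=
  Nat.lt_pow_succ_log_self hp.out.one_lt _

omit hp in
/-- `windowMod p W ≤ p·(2W + 1)`. [cite: AlmanWilliams2015, Lemma 3.1] -/
theorem windowMod_le (W : ℕ) : windowMod p W ≤ p * (2 * W + 1) := by
  unfold windowMod
  rw [pow_succ']
  refine Nat.mul_le_mul_left _ ?_
  rcases Nat.eq_zero_or_pos (2 * W) with h | h
  · rw [h, Nat.log_zero_right, pow_zero]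
    omega
  · exact (Nat.pow_log_le_self p h.ne').trans (Nat.le_succ _)

/-- **The window polynomial** for the threshold `t` with half-width `W` over `𝔽_p`:
`Σ_{j=0}^{W} [|x| ≡ t + j (mod q)]`, `q = windowMod p W`.
[cite: AlmanWilliams2015, Lemma 3.1 (the polynomial A_{n,θ,g}: exact on a weight window)] -/
def windowThr (t W : ℕ) : CubeFn (ZMod p) n :=
  ∑ j ∈ Finset.range (W + 1), modInd (ZMod p) (windowMod p W) (t + j)

/-- The window polynomial has degree `≤ p(2W+1)` (indeed `< windowMod p W`).
[cite: AlmanWilliams2015, Lemma 3.1 (degree at most 2g√n + 1 = window width)] -/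
theorem windowThr_mem_lowDeg (t W : ℕ) {D : ℕ} (hD : p * (2 * W + 1) ≤ D) :
    windowThr (n := n) p t W ∈ lowDeg (ZMod p) n D := by
  unfold windowThr
  refine Submodule.sum_mem _ fun j _ => ?_
  unfold windowMod
  refine modInd_mem_lowDeg _ _ ?_
  have := windowMod_le p W
  unfold windowMod at this
  omega

/-- **Exactness on the window**: if `t ≤ |x| + W` and `|x| ≤ t + W` then
`windowThr p t W x = [t ≤ |x|]`. [cite: AlmanWilliams2015, Lemma 3.1 (correct on all x with |x| in the window)] -/
theorem windowThr_apply (t W : ℕ) (x : Fin n → Bool) (hlo : t ≤ GateFn.numOnes x + W)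
    (hhi : GateFn.numOnes x ≤ t + W) :
    windowThr p t W x = if t ≤ GateFn.numOnes x then 1 else 0 := by
  set q := windowMod p W with hq
  have hqW : 2 * W < q := two_mul_lt_windowMod p W
  have hq0 : 0 < q := by omega
  set N := GateFn.numOnes x with hN
  unfold windowThr
  rw [Finset.sum_apply]
  simp only [modInd, ← hq, ← hN]
  split_ifs with ht
  · -- `N = t + j₀` with `j₀ ≤ W`: exactly the term `j₀` is `1`
    obtain ⟨j₀, hj₀⟩ : ∃ j₀, N = t + j₀ := ⟨N - t, by omega⟩
    have hj₀W : j₀ ≤ W := by omega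
    rw [Finset.sum_eq_single j₀]
    · rw [if_pos (by rw [hj₀])]
    · intro j hj hne
      rw [if_neg]
      intro heq
      rw [hj₀] at heq
      have h1 : j₀ % q = j % q := by
        have := Nat.ModEq.add_left_cancel' t (show t + j₀ ≡ t + j [MOD q] from heq)
        exact this
      rw [Nat.mod_eq_of_lt (by omega), Nat.mod_eq_of_lt (by
        have := Finset.mem_range.1 hj; omega)] at h1
      exact hne h1.symm
    · intro h
      exact absurd (Finset.mem_range.2 (by omega)) h
  · -- `N = t - s`, `1 ≤ s ≤ W`: no term fires
    refine Finset.sum_eq_zero fun j hj => ?_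
    rw [if_neg]
    intro heq
    have hjW : j < W + 1 := Finset.mem_range.1 hj
    -- `N ≡ t + j`, and `N + (t - N) = t`, so `0 ≡ j + (t - N)` mod `q`, impossible as `0 < j + (t-N) < q`
    have h1 : (N + (t - N)) % q = (t + j + (t - N)) % q := Nat.ModEq.add_right (t - N) heq
    have h2 : N + (t - N) = t := by omega
    rw [h2] at h1
    have h3 : t % q = (t + (j + (t - N))) % q := by rw [h1]; ring_nf
    have h4 := Nat.ModEq.add_left_cancel' t (show t + 0 ≡ t + (j + (t - N)) [MOD q] by
      rw [add_zero]; exact h3)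
    rw [Nat.ModEq, Nat.zero_mod, Nat.mod_eq_of_lt (by omega)] at h4
    omega

end Window

end Smolensky

end Literature.Computability.MetaComplexity
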